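import Summits.FinalStateConjecture.FinalStateConjecture.Theses.PhaseMixingCapture
import Literature.Geometry.Lorentzian.KerrDataProofs
import Literature.Geometry.Lorentzian.KerrSchildCoord
import Literature.Geometry.Lorentzian.KerrHyperboloidalLeaves
import Literature.Geometry.Lorentzian.IsometryProofs
import Literature.Geometry.Lorentzian.LeviCivitaProofs

/-!
# `NearExtremalKappaCapture` (crux stmt-FinalStateConjecture-10606, route PhaseMixingCapture):
# read-back, exponent monotonicity, one-exponent normal form, exact-Kerr pinning, third-law fork
# (negative-side support, cdisprove seat)

Support file of the crux disprover. Nothing here closes the crux; everything is `sorry`-free.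

* §0 `FarComplete`, `CaptureWith`, `near_iff` (`Iff.rfl`): the crux is
  `∀ [Kerr.Facts] [Kerr.SliceFacts], ∃ (s δ k γ p a₁), a₁ < 1 ∧ CaptureWith s δ k γ p a₁`.
* §1 `Kerr.Facts` holds outright (tree theorem `SwallowTheDatum.kerrFacts`, not re-declared here);
  `sliceFacts_of`: `Kerr.SliceFacts` reduces to its two still-unproved fields `Kerr.sliceK_symm`,
  `Kerr.contMDiff_sliceK`.
* §2 `weightedSobolevSeminorm_mono_exponents`, `dataWeightedSobolevEDist_mono` (the data distance is
  monotone in `(s, δ)`), `captureWith_mono` — the admissible exponent vectors form an UP-SET in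
  `(s, δ, γ, p, a₁)` and a down-set in `k` — hence the one-exponent normal form `near_iff_diagonal`
  (`NearExtremalKappaCapture ↔ ∀ [..], ∃ a₁ < 1, ∃ N : ℕ, CaptureWith N N 0 N N a₁`) and
  `not_near_iff`: a disproof must show super-polynomial degeneration (failure for every `N`).
* §3 `captureWith_self`: at the exact Kerr datum (`dist = 0`) the modulus pins `M' = M`, `a' = a`;
  granted the constraint fact `Kerr.data_isVacuumConstraintSolution M a M`, every MGHD of
  `Kerr.data M a M` must be far-complete and `ConvergesToKerr 𝒟oc M a k`.
* §4 `ExtremalFormationInBasin` and `captureWith_false_of_extremalFormation`: the conjunct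
  `Kerr.IsSubextremal M' a'` of the conclusion is load-bearing — non-subextremal Kerr limits forming
  inside every `c (1 − a²/M²)^γ`-basin refute capture with that `γ` for all `k, p` (energetically
  this fork reaches only `γ < 1/2`; by §2 a proof may and must take `γ` larger).

References: Angelopoulos–Kehle–Unger arXiv:2603.10378 (uniform basin in symmetry); Kehle–Unger
arXiv:2211.15742 and arXiv:2402.10190 (extremal black hole formation, third law); Bartnik, CPAM 39
(1986), (1.2) (weighted Sobolev norms).
-/

noncomputable section

namespace Summit.FinalStateConjecture.FinalStateConjecture.Theorems.NearExtremalKappaCapture.Negative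

open Literature.Geometry.Lorentzian
open scoped Manifold ContDiff Topology ENNReal
open Set Filter

/-! ## §0  The crux unfolded: far-completeness clause and the body at a fixed exponent vector -/

/-- The far-origin sojourn form of "complete future null infinity" for a vacuum Cauchy development
`𝒟` of data on the Kerr–Schild slice `Kerr.slice a M` — VERBATIM the second conjunct of the crux's
conclusion (itself the inlined body of `DataEmbedding.HasCompleteFutureNullInfinityFar`). -/
def FarComplete [Kerr.SliceFacts] {a M : ℝ} {D : InitialDataSet 𝓘(ℝ, E3) (Kerr.slice a M)}
    (𝒟 : VacuumCauchyDevelopment D) : Prop :=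
  ∀ [𝒟.metric.HasLeviCivita], ∃ B₀ : Set (Kerr.slice a M), IsCompact B₀ ∧ ∀ σ : ℝ, 0 < σ →
    ∃ B₁ : Set (Kerr.slice a M), IsCompact B₁ ∧
      ∀ q ∈ {q : Kerr.slice a M | Kerr.afRadius a M + 1 ≤ ‖(q : E3)‖}, q ∉ B₁ →
        ∀ (ray : ℝ → 𝒟.carrier) (dom : Set ℝ),
          𝒟.metric.IsNormalisedNullRayFrom 𝒟.timeOrientation 𝒟.embed 𝒟.normal q ray dom →
            ¬ BddAbove dom ∨ ENNReal.ofReal σ ≤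
              sojournTime ray dom (𝒟.metric.causalFuture 𝒟.timeOrientation (𝒟.embed '' B₀))

/-- The body of the crux at a FIXED exponent vector `(s, δ, k, γ, p, a₁)`: κ-explicit capture of
the spins `a₁ M ≤ |a| < M` with basin `c (1 − (a/M)²)^γ` and modulus `C (1 − (a/M)²)^(−p) √dist`. -/
def CaptureWith [Kerr.Facts] [Kerr.SliceFacts] (s : ℕ) (δ : ℝ) (k : ℕ) (γ p a₁ : ℝ) : Prop :=
  ∀ (M : ℝ) (hM : 0 < M), ∃ c > (0 : ℝ), ∃ C : ℝ, ∀ a : ℝ, a₁ * M ≤ |a| →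
    Kerr.IsSubextremal M a →
      ∀ (D : InitialDataSet 𝓘(ℝ, E3) (Kerr.slice a M)) [D.metric.HasLeviCivita],
        D.IsVacuumConstraintSolution →
          InitialDataSet.dataWeightedSobolevEDist s δ D (Kerr.data M a M hM.le) <
              ENNReal.ofReal (c * (1 - (a / M) ^ 2) ^ γ) →
            ∀ 𝒟 : VacuumCauchyDevelopment D, 𝒟.IsMaximal →
              ∃ (M' a' : ℝ) (𝒟oc : Set 𝒟.carrier), Kerr.IsSubextremal M' a' ∧ FarComplete 𝒟 ∧
                𝒟.toSpacetime.ConvergesToKerr 𝒟oc M' a' k ∧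
                  |M' - M| + |a' - a| ≤ C * (1 - (a / M) ^ 2) ^ (-p) *
                    √(InitialDataSet.dataWeightedSobolevEDist s δ D (Kerr.data M a M hM.le)).toReal

/-- The crux is `∀ [Kerr.Facts] [Kerr.SliceFacts], ∃ exponents, a₁ < 1 ∧ CaptureWith …`
(definitional unfolding). -/
theorem near_iff :
    Theses.PhaseMixingCapture.NearExtremalKappaCapture ↔
      ∀ [Kerr.Facts] [Kerr.SliceFacts], ∃ (s : ℕ) (δ : ℝ) (k : ℕ) (γ p a₁ : ℝ),
        a₁ < 1 ∧ CaptureWith s δ k γ p a₁ :=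
  Iff.rfl

/-! ## §1  The instance binders `[Kerr.Facts] [Kerr.SliceFacts]` -/

-- `Kerr.Facts` itself is the tree theorem `SwallowTheDatum.kerrFacts` (SwallowTheDatumTargetGlue.lean).

/-- `Kerr.SliceFacts` REDUCES to its two fields that are not yet theorems of the tree — symmetry
(`Kerr.sliceK_symm`) and smoothness (`Kerr.contMDiff_sliceK`) of the second fundamental form of the
Kerr–Schild slice; the other four fields are discharged (`Kerr.isConnected_slice_holds`,
`PseudoRiemannianMetric.contMDiff_pullbackBilin_holds`,
`PseudoRiemannianMetric.isCovariantDerivativeOn_leviCivitaFun_holds`,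
`Kerr.isSpacelikeImmersion_sliceEmbed_holds`). An unconditional `¬ NearExtremalKappaCapture` must
supply these two facts (both printed theorems: O'Neill 1983, Ch. 4, Lemma 4.4; Cook 2000, (57)). -/
theorem sliceFacts_of (h₁ : ∀ [Kerr.Facts] (M a r₀ : ℝ), Kerr.sliceK_symm M a r₀)
    (h₂ : ∀ [Kerr.Facts] (M a r₀ : ℝ), Kerr.contMDiff_sliceK M a r₀) : Kerr.SliceFacts where
  isConnected_slice := Kerr.isConnected_slice_holds
  contMDiff_pullbackBilin _ _ := PseudoRiemannianMetric.contMDiff_pullbackBilin_holds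
  isCovariantDerivativeOn_leviCivitaFun _ _ _ :=
    PseudoRiemannianMetric.isCovariantDerivativeOn_leviCivitaFun_holds
  isSpacelikeImmersion_sliceEmbed := Kerr.isSpacelikeImmersion_sliceEmbed_holds
  sliceK_symm := h₁
  contMDiff_sliceK := h₂

/-! ## §2  Monotonicity in the exponents; the one-exponent normal form -/

section Mono

variable {F G : Type*} [NormedAddCommGroup F] [NormedSpace ℝ F] [NormedAddCommGroup G]
  [NormedSpace ℝ G] [MeasureTheory.MeasureSpace F]

/-- The weighted Sobolev seminorm `‖f‖_{H^s_δ(U)}` is monotone in the order `s` (more terms) and in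
the weight `δ` (`(1 + ‖x‖)^{2(δ+m)}` is monotone in `δ` since `1 + ‖x‖ ≥ 1`). Bartnik 1986, (1.2). -/
theorem weightedSobolevSeminorm_mono_exponents (U : Set F) {s s' : ℕ} (hs : s ≤ s') {δ δ' : ℝ}
    (hδ : δ ≤ δ') (f : F → G) :
    weightedSobolevSeminorm U s δ f ≤ weightedSobolevSeminorm U s' δ' f := by
  unfold weightedSobolevSeminorm
  refine ENNReal.rpow_le_rpow ?_ (by norm_num)
  calc ∑ m ∈ Finset.range (s + 1), ∫⁻ x in U,
          ENNReal.ofReal ((1 + ‖x‖) ^ (2 * (δ + m) : ℝ) * ‖iteratedFDeriv ℝ m f x‖ ^ 2)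
      ≤ ∑ m ∈ Finset.range (s + 1), ∫⁻ x in U,
          ENNReal.ofReal ((1 + ‖x‖) ^ (2 * (δ' + m) : ℝ) * ‖iteratedFDeriv ℝ m f x‖ ^ 2) := by
        refine Finset.sum_le_sum fun m _ ↦ MeasureTheory.lintegral_mono fun x ↦ ?_
        refine ENNReal.ofReal_le_ofReal (mul_le_mul_of_nonneg_right ?_ (sq_nonneg _))
        exact Real.rpow_le_rpow_of_exponent_le (by linarith [norm_nonneg x]) (by linarith)
    _ ≤ ∑ m ∈ Finset.range (s' + 1), ∫⁻ x in U,
          ENNReal.ofReal ((1 + ‖x‖) ^ (2 * (δ' + m) : ℝ) * ‖iteratedFDeriv ℝ m f x‖ ^ 2) :=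
        Finset.sum_le_sum_of_subset (Finset.range_mono (by omega))

end Mono

/-- The weighted Sobolev DISTANCE of two data sets is monotone in `(s, δ)`: a larger `s` or `δ`
gives a larger distance, hence a SMALLER basin `{dist < ε}`. -/
theorem dataWeightedSobolevEDist_mono {U : TopologicalSpace.Opens E3} {s s' : ℕ} (hs : s ≤ s')
    {δ δ' : ℝ} (hδ : δ ≤ δ') (D₁ D₂ : InitialDataSet 𝓘(ℝ, E3) U) :
    InitialDataSet.dataWeightedSobolevEDist s δ D₁ D₂ ≤
      InitialDataSet.dataWeightedSobolevEDist s' δ' D₁ D₂ := by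
  unfold InitialDataSet.dataWeightedSobolevEDist
  exact add_le_add (weightedSobolevSeminorm_mono_exponents _ hs hδ _)
    (weightedSobolevSeminorm_mono_exponents _ (Nat.sub_le_sub_right hs 1) (by linarith) _)

/-- `0 < 1 − (a/M)² ≤ 1` on the sub-extremal range. -/
theorem kappaSq_pos_le_one {M a : ℝ} (h : Kerr.IsSubextremal M a) :
    0 < 1 - (a / M) ^ 2 ∧ 1 - (a / M) ^ 2 ≤ 1 := by
  have hM : 0 < M := h.pos
  have h1 : |a / M| < 1 := by
    rw [abs_div, abs_of_pos hM, div_lt_one hM]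
    exact h
  have h2 : (a / M) ^ 2 < 1 := (sq_lt_one_iff_abs_lt_one _).mpr h1
  exact ⟨by linarith, by linarith [sq_nonneg (a / M)]⟩

/-- **The admissible exponent vectors form an up-set.** If capture holds with `(s, δ, k, γ, p, a₁)`
then it holds with every `s' ≥ s`, `δ' ≥ δ` (smaller basin in a stronger norm, larger modulus),
`k' ≤ k` (weaker convergence), `γ' ≥ γ` (smaller basin: `(1 − (a/M)²)^γ' ≤ (1 − (a/M)²)^γ` as the
base lies in `(0, 1]`), `p' ≥ p` (weaker modulus) and `a₁' ≥ a₁` (fewer spins). In particular a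
REFUTATION must defeat arbitrarily large `(s, δ, γ, p)` at once: super-polynomial degeneration. -/
theorem captureWith_mono [Kerr.Facts] [Kerr.SliceFacts] {s s' : ℕ} {δ δ' : ℝ} {k k' : ℕ}
    {γ γ' p p' a₁ a₁' : ℝ} (h : CaptureWith s δ k γ p a₁) (hs : s ≤ s') (hδ : δ ≤ δ')
    (hk : k' ≤ k) (hγ : γ ≤ γ') (hp : p ≤ p') (ha₁ : a₁ ≤ a₁') :
    CaptureWith s' δ' k' γ' p' a₁' := by
  intro M hM
  obtain ⟨c, hc, C, h⟩ := h M hM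
  refine ⟨c, hc, max C 0, fun a ha hsub D _ hvac hdist 𝒟 hmax ↦ ?_⟩
  obtain ⟨hx0, hx1⟩ := kappaSq_pos_le_one hsub
  have ha' : a₁ * M ≤ |a| := (mul_le_mul_of_nonneg_right ha₁ hM.le).trans ha
  -- the `(s', δ')`-basin of radius `c x^γ'` lies in the `(s, δ)`-basin of radius `c x^γ`
  have hle : InitialDataSet.dataWeightedSobolevEDist s δ D (Kerr.data M a M hM.le) ≤
      InitialDataSet.dataWeightedSobolevEDist s' δ' D (Kerr.data M a M hM.le) :=
    dataWeightedSobolevEDist_mono hs hδ _ _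
  have hdist' : InitialDataSet.dataWeightedSobolevEDist s δ D (Kerr.data M a M hM.le) <
      ENNReal.ofReal (c * (1 - (a / M) ^ 2) ^ γ) := by
    refine (hle.trans_lt hdist).trans_le (ENNReal.ofReal_le_ofReal ?_)
    exact mul_le_mul_of_nonneg_left (Real.rpow_le_rpow_of_exponent_ge hx0 hx1 hγ) hc.le
  obtain ⟨M', a', 𝒟oc, hsub', hfar, hconv, hmod⟩ := h a ha' hsub D hvac hdist' 𝒟 hmax
  refine ⟨M', a', 𝒟oc, hsub', hfar, Spacetime.ConvergesTo.of_le hconv hk, hmod.trans ?_⟩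
  have hne : InitialDataSet.dataWeightedSobolevEDist s' δ' D (Kerr.data M a M hM.le) ≠ ⊤ :=
    ne_top_of_lt hdist
  have hsqrt : √(InitialDataSet.dataWeightedSobolevEDist s δ D (Kerr.data M a M hM.le)).toReal ≤
      √(InitialDataSet.dataWeightedSobolevEDist s' δ' D (Kerr.data M a M hM.le)).toReal :=
    Real.sqrt_le_sqrt (ENNReal.toReal_mono hne hle)
  have hpow : (1 - (a / M) ^ 2) ^ (-p) ≤ (1 - (a / M) ^ 2) ^ (-p') :=
    Real.rpow_le_rpow_of_exponent_ge hx0 hx1 (neg_le_neg hp)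
  have hpow0 : 0 ≤ (1 - (a / M) ^ 2) ^ (-p) := Real.rpow_nonneg hx0.le _
  have hpow0' : 0 ≤ (1 - (a / M) ^ 2) ^ (-p') := Real.rpow_nonneg hx0.le _
  calc C * (1 - (a / M) ^ 2) ^ (-p) *
        √(InitialDataSet.dataWeightedSobolevEDist s δ D (Kerr.data M a M hM.le)).toReal
      ≤ max C 0 * (1 - (a / M) ^ 2) ^ (-p) *
        √(InitialDataSet.dataWeightedSobolevEDist s δ D (Kerr.data M a M hM.le)).toReal :=
        mul_le_mul_of_nonneg_right (mul_le_mul_of_nonneg_right (le_max_left C 0) hpow0)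
          (Real.sqrt_nonneg _)
    _ ≤ max C 0 * (1 - (a / M) ^ 2) ^ (-p') *
        √(InitialDataSet.dataWeightedSobolevEDist s' δ' D (Kerr.data M a M hM.le)).toReal :=
        mul_le_mul (mul_le_mul_of_nonneg_left hpow (le_max_right _ _)) hsqrt (Real.sqrt_nonneg _)
          (mul_nonneg (le_max_right _ _) hpow0')

/-- **One-exponent normal form.** `NearExtremalKappaCapture` holds iff for some `a₁ < 1` and some
single natural number `N` capture holds with `s = N`, `δ = γ = p = N` and `C⁰` convergence
(`k = 0`). (→: take `N ≥ s, ⌈δ⌉, ⌈γ⌉, ⌈p⌉` and use `captureWith_mono`; ←: trivial.) This is the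
precise sense in which the crux says "the constants are POLYNOMIAL in the surface gravity". -/
theorem near_iff_diagonal :
    Theses.PhaseMixingCapture.NearExtremalKappaCapture ↔
      ∀ [Kerr.Facts] [Kerr.SliceFacts], ∃ (a₁ : ℝ) (N : ℕ),
        a₁ < 1 ∧ CaptureWith N (N : ℝ) 0 (N : ℝ) (N : ℝ) a₁ := by
  rw [near_iff]
  constructor
  · intro h hF hS
    obtain ⟨s, δ, k, γ, p, a₁, ha₁, h⟩ := @h hF hS
    refine ⟨a₁, max (max s ⌈δ⌉₊) (max ⌈γ⌉₊ ⌈p⌉₊), ha₁, ?_⟩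
    set N : ℕ := max (max s ⌈δ⌉₊) (max ⌈γ⌉₊ ⌈p⌉₊) with hN
    have hsN : s ≤ N := by omega
    have hδN : δ ≤ (N : ℝ) := (Nat.le_ceil δ).trans (by exact_mod_cast (by omega : ⌈δ⌉₊ ≤ N))
    have hγN : γ ≤ (N : ℝ) := (Nat.le_ceil γ).trans (by exact_mod_cast (by omega : ⌈γ⌉₊ ≤ N))
    have hpN : p ≤ (N : ℝ) := (Nat.le_ceil p).trans (by exact_mod_cast (by omega : ⌈p⌉₊ ≤ N))
    exact captureWith_mono h hsN hδN (Nat.zero_le k) hγN hpN le_rfl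
  · intro h hF hS
    obtain ⟨a₁, N, ha₁, h⟩ := @h hF hS
    exact ⟨N, N, 0, N, N, a₁, ha₁, h⟩

/-- **What a disproof must show** (contrapositive bookkeeping of `near_iff_diagonal`): granted the
two instance facts, `¬ NearExtremalKappaCapture` iff for EVERY `a₁ < 1` and EVERY `N`, capture with
basin `c (1 − a²/M²)^N`, modulus `C (1 − a²/M²)^{−N}`, norm `H^N_N` and `C⁰` convergence fails for
some `M > 0` whatever `c, C` — i.e. the basin or the modulus degenerates faster than every power of
the surface gravity. -/
theorem not_near_iff [hF : Kerr.Facts] [hS : Kerr.SliceFacts] :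
    ¬ Theses.PhaseMixingCapture.NearExtremalKappaCapture ↔
      ∀ (a₁ : ℝ) (N : ℕ), a₁ < 1 → ¬ CaptureWith N (N : ℝ) 0 (N : ℝ) (N : ℝ) a₁ := by
  rw [near_iff_diagonal]
  constructor
  · intro h a₁ N ha₁ hc
    exact h fun {_ _} ↦ ⟨a₁, N, ha₁, by convert hc⟩
  · rintro h h'
    obtain ⟨a₁, N, ha₁, hc⟩ := @h' hF hS
    exact h a₁ N ha₁ hc

/-! ## §3  The crux at the exact Kerr datum (`dist = 0`): parameters are pinned -/

/-- **Exact-Kerr self-consistency.** Granted the constraint equations for the Kerr–Schild slice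
data at spin `a` (the named fact `Kerr.data_isVacuumConstraintSolution M a M`, a theorem in the tree
only for `a = 0`), capture with ANY exponents forces every maximal vacuum Cauchy development of the
exact Kerr datum `Kerr.data M a M` (`a₁ M ≤ |a| < M`) to have far-complete `𝓘⁺` and to converge in
`Cᵏ`, in the Kerr–Schild pullback gauge, to Kerr with THE SAME parameters `(M, a)`: at `dist = 0`
the modulus reads `|M' − M| + |a' − a| ≤ 0`. This is the cheapest necessary condition of the crux;
on paper it holds (module docstring), so `dist = 0` gives no kill. -/
theorem captureWith_self [Kerr.Facts] [Kerr.SliceFacts] {s : ℕ} {δ : ℝ} {k : ℕ} {γ p a₁ : ℝ}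
    (h : CaptureWith s δ k γ p a₁) {M : ℝ} (hM : 0 < M) {a : ℝ} (ha : a₁ * M ≤ |a|)
    (hsub : Kerr.IsSubextremal M a) (hvac : Kerr.data_isVacuumConstraintSolution M a M)
    [(Kerr.data M a M hM.le).metric.HasLeviCivita]
    (𝒟 : VacuumCauchyDevelopment (Kerr.data M a M hM.le)) (hmax : 𝒟.IsMaximal) :
    FarComplete 𝒟 ∧ ∃ 𝒟oc : Set 𝒟.carrier, 𝒟.toSpacetime.ConvergesToKerr 𝒟oc M a k := by
  obtain ⟨c, hc, C, h⟩ := h M hM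
  obtain ⟨hx0, -⟩ := kappaSq_pos_le_one hsub
  have hd : InitialDataSet.dataWeightedSobolevEDist s δ (Kerr.data M a M hM.le)
      (Kerr.data M a M hM.le) = 0 :=
    InitialDataSet.dataWeightedSobolevEDist_self s δ _
  have hbasin : InitialDataSet.dataWeightedSobolevEDist s δ (Kerr.data M a M hM.le)
      (Kerr.data M a M hM.le) < ENNReal.ofReal (c * (1 - (a / M) ^ 2) ^ γ) := by
    rw [hd]
    exact ENNReal.ofReal_pos.mpr (mul_pos hc (Real.rpow_pos_of_pos hx0 γ))
  obtain ⟨M', a', 𝒟oc, -, hfar, hconv, hmod⟩ :=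
    h a ha hsub (Kerr.data M a M hM.le) (hvac hM.le) hbasin 𝒟 hmax
  rw [hd, ENNReal.toReal_zero, Real.sqrt_zero, mul_zero] at hmod
  have h1 : M' = M := by
    have : |M' - M| ≤ 0 := by linarith [abs_nonneg (a' - a)]
    exact sub_eq_zero.mp (abs_nonpos_iff.mp this)
  have h2 : a' = a := by
    have : |a' - a| ≤ 0 := by linarith [abs_nonneg (M' - M)]
    exact sub_eq_zero.mp (abs_nonpos_iff.mp this)
  subst h1 h2
  exact ⟨hfar, 𝒟oc, hconv⟩

/-! ## §4  The load-bearing conjunct `IsSubextremal M' a'`: the third-law fork -/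

/-- `H(s, δ, γ, a₁)` — **non-subextremal Kerr limits form inside every `κ̂^{2γ}`-basin**: for some
mass `M`, however small the basin constant `c`, some spin `a₁ M ≤ |a| < M` carries a vacuum datum
within `dist < c (1 − (a/M)²)^γ` of the Kerr datum having a maximal development ALL of whose
Kerr–Schild `C⁰`-limits `(M', a')` (if any) fail `|a'| < M'`. This packages (i) a Kehle–Unger-type
"the third law is false" statement transplanted to vacuum and to a NEIGHBOURHOOD of near-extremal
Kerr (extremal Kerr forms from data `√dist`-close to `Kerr(M, a)`), and (ii) rigidity of the limit
parameters (a development converging to extremal Kerr converges to no sub-extremal one). Open;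
energetically plausible exactly when `γ < 1/2` (radiating `M − √(aM) ≈ Mκ̂²/4` at fixed `J` costs
perturbation size `≳ κ̂`). [cite: KehleUnger2025] [cite: KehleUnger2024] -/
def ExtremalFormationInBasin [Kerr.Facts] [Kerr.SliceFacts] (s : ℕ) (δ γ a₁ : ℝ) : Prop :=
  ∃ (M : ℝ) (hM : 0 < M), ∀ c > (0 : ℝ), ∃ a : ℝ, a₁ * M ≤ |a| ∧ Kerr.IsSubextremal M a ∧
    ∃ (D : InitialDataSet 𝓘(ℝ, E3) (Kerr.slice a M)) (_ : D.metric.HasLeviCivita),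
      D.IsVacuumConstraintSolution ∧
        InitialDataSet.dataWeightedSobolevEDist s δ D (Kerr.data M a M hM.le) <
            ENNReal.ofReal (c * (1 - (a / M) ^ 2) ^ γ) ∧
          ∃ 𝒟 : VacuumCauchyDevelopment D, 𝒟.IsMaximal ∧
            ∀ (M' a' : ℝ) (𝒟oc : Set 𝒟.carrier),
              𝒟.toSpacetime.ConvergesToKerr 𝒟oc M' a' 0 → ¬ Kerr.IsSubextremal M' a'

/-- **Energy gap to extremality at fixed angular momentum.** For `0 ≤ a ≤ M`, `0 < M`:
`M − √(aM) ≥ (M/4)(1 − (a/M)²)`. In axisymmetry `J = aM` is conserved, so a development of data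
near `Kerr(M, a)` can only settle to an EXTREMAL hole (`M_f² = J`) after radiating at least
`M − √(aM) ≥ M κ̂²/4` (`κ̂² = 1 − a²/M²`) through `𝓘⁺`; radiated energy being quadratic in the
perturbation, the third-law fork `ExtremalFormationInBasin s δ γ a₁` is energetically barred once the
basin radius `c κ̂^{2γ}` is `o(κ̂)` in amplitude, i.e. for `γ > 1/2` (heuristic dictionary
`√dist ~` amplitude). [folklore] -/
theorem extremalityGap_ge {M a : ℝ} (hM : 0 < M) (ha0 : 0 ≤ a) (haM : a ≤ M) :
    M / 4 * (1 - (a / M) ^ 2) ≤ M - √(a * M) := by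
  have ht0 : 0 ≤ a / M := div_nonneg ha0 hM.le
  have ht1 : a / M ≤ 1 := (div_le_one hM).mpr haM
  set t := a / M with ht
  have hs : √(a * M) = M * √t := by
    rw [ht, show a * M = M ^ 2 * (a / M) by field_simp, Real.sqrt_mul (sq_nonneg M),
      Real.sqrt_sq hM.le]
  rw [hs]
  set s := √t with hsdef
  have hs0 : 0 ≤ s := Real.sqrt_nonneg t
  have hs1 : s ≤ 1 := Real.sqrt_le_one.mpr ht1
  have hss : s ^ 2 = t := Real.sq_sqrt ht0
  have key : (1 - t ^ 2) / 4 ≤ 1 - s := by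
    rw [← hss]
    nlinarith [mul_nonneg hs0 hs0, mul_nonneg (mul_nonneg hs0 hs0) hs0, sub_nonneg.mpr hs1,
      mul_nonneg (sub_nonneg.mpr hs1) (mul_nonneg hs0 hs0)]
  nlinarith [key, hM]

/-- … and the gap is at most `M − a` (`√(aM) ≥ a`): the energy to extremality is COMPARABLE to
`M κ̂²` on the near-extremal range (`M − a = M κ̂²/(1 + a/M) ∈ [Mκ̂²/2, Mκ̂²]`). [folklore] -/
theorem extremalityGap_le {M a : ℝ} (ha0 : 0 ≤ a) (haM : a ≤ M) :
    M - √(a * M) ≤ M - a := by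
  have h1 : √(a * a) = a := Real.sqrt_mul_self ha0
  have : a ≤ √(a * M) := by
    calc a = √(a * a) := h1.symm
      _ ≤ √(a * M) := Real.sqrt_le_sqrt (mul_le_mul_of_nonneg_left haM ha0)
  linarith

/-- **Third-law fork.** If non-subextremal Kerr limits form inside every `κ̂^{2γ}`-basin
(`ExtremalFormationInBasin s δ γ a₁`), then capture with that `(s, δ, γ, a₁)` fails for ALL `k, p`:
the conclusion's conjunct `Kerr.IsSubextremal M' a'` is load-bearing, and (by §2) any proof must use
a basin exponent `γ` beyond the reach of extremal formation (energetically `γ ≥ 1/2`). -/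
theorem captureWith_false_of_extremalFormation [Kerr.Facts] [Kerr.SliceFacts] {s : ℕ}
    {δ γ a₁ : ℝ} (H : ExtremalFormationInBasin s δ γ a₁) (k : ℕ) (p : ℝ) :
    ¬ CaptureWith s δ k γ p a₁ := by
  intro h
  obtain ⟨M, hM, H⟩ := H
  obtain ⟨c, hc, C, h⟩ := h M hM
  obtain ⟨a, ha, hsub, D, inst, hvac, hdist, 𝒟, hmax, hlim⟩ := H c hc
  obtain ⟨M', a', 𝒟oc, hsub', -, hconv, -⟩ := h a ha hsub D hvac hdist 𝒟 hmax
  exact hlim M' a' 𝒟oc (Spacetime.ConvergesTo.of_le hconv (Nat.zero_le k)) hsub'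

end Summit.FinalStateConjecture.FinalStateConjecture.Theorems.NearExtremalKappaCapture.Negative

end
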